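import Summits.RiemannHypothesis.RiemannHypothesis.Theorems.Splittings.SplitXWucK1RD
import HarnessLib

/-!
# Splittings — x-wuc GEN-11 `SplitXWucK1R` (K1′(ℝ) AT THE STAKE) — mechanical carve part 5/14
Continuation of `Summits.RiemannHypothesis.RiemannHypothesis.Theorems.Splittings.SplitXWucK1RD`: byte-identical declaration units of the referee-passed extract `SplitXWucK1R.lean`
sha16 70c8eb2af2868881 (x-wuc g11; ref g10 PASS 2026-08-27T22:59:46Z; RULING #330); open namespaces/sections re-opened with their context.
HONEST LABEL: splitting search over kernel-typed RH-equivalences; K-CERT′ (complex `f`) stays OPEN; nothing here bears on the truth of RH.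
-/
set_option linter.dupNamespace false
noncomputable section
open scoped Classical ComplexConjugate
open Set Filter Topology Complex MeasureTheory
open Real Set Filter Topology
open Real Set MeasureTheory Complex Filter Topology
open scoped Real
namespace Summit.RiemannHypothesis.RiemannHypothesis.Theorems.Splittings.XWucG8.DSLine
open scoped ComplexConjugate
section profile
/-- `κ ↦ (1 + κ²/6)·X − cosh κ` is antitone on `[0, ∞)` for `X ≤ 2`. -/
theorem antitoneOn_psi {X : ℝ} (hX : X ≤ 2) :
    AntitoneOn (fun κ : ℝ => (1 + κ ^ 2 / 6) * X - Real.cosh κ) (Ici 0) := by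
  have hderiv : ∀ x : ℝ, HasDerivAt (fun κ : ℝ => (1 + κ ^ 2 / 6) * X - Real.cosh κ)
      ((2 * x / 6) * X - Real.sinh x) x := by
    intro x
    have h2 : HasDerivAt (fun κ : ℝ => 1 + κ ^ 2 / 6) (2 * x / 6) x := by
      have := ((hasDerivAt_pow 2 x).div_const 6).const_add (1 : ℝ)
      simpa using this
    exact (h2.mul_const X).sub (Real.hasDerivAt_cosh x)
  apply antitoneOn_of_deriv_nonpos (convex_Ici 0) (by fun_prop : Continuous _).continuousOn
  · exact fun x _ => (hderiv x).differentiableAt.differentiableWithinAt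
  · intro x hx
    rw [interior_Ici] at hx
    have hx0 : 0 < x := hx
    rw [(hderiv x).deriv]
    have := Real.self_le_sinh_iff.mpr hx0.le
    nlinarith

/-- the cosine lobe at a maximiser of `‖tfT g · 0‖` (Duffin–Schaeffer inequality + DS lobe). -/
theorem lobe_at_max (g : ℝ → ℂ) (hg : Continuous g) {lam₀ M : ℝ} (hM : 0 < M)
    (hmax : ∀ y : ℝ, ‖tfT g y 0‖ ≤ M) (hat : ‖tfT g lam₀ 0‖ = M) {t : ℝ} (ht : |t| ≤ π) :
    M * Real.cos t ≤ ‖tfT g (lam₀ + t) 0‖ := by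
  set c : ℂ := conj (tfT g lam₀ 0) / (M : ℂ) with hc
  have hc1 : ‖c‖ = 1 := by
    rw [hc, norm_div, RCLike.norm_conj, hat, Complex.norm_real, Real.norm_eq_abs, abs_of_pos hM,
      div_self hM.ne']
  set S : ℝ → ℝ := fun y => (c * tfT g y 0).re with hS
  have hSd : ∀ y, HasDerivAt S ((c * tfT₁ g y).re) y := by
    intro y
    have h1 := (hasDerivAt_tfT g hg y).const_mul c
    exact Complex.reCLM.hasFDerivAt.comp_hasDerivAt y h1
  have hSdiff : Differentiable ℝ S := fun y => (hSd y).differentiableAt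
  have hDS : ∀ y, deriv S y ^ 2 + S y ^ 2 ≤ M ^ 2 := by
    intro y
    rw [(hSd y).deriv]
    have := re_sq_add_re_sq_le g hg M hmax c hc1.le y
    simp only [hS]; linarith
  have hS0 : S lam₀ = M := by
    have e : c * tfT g lam₀ 0 = ((Complex.normSq (tfT g lam₀ 0) / M : ℝ) : ℂ) := by
      rw [hc, div_mul_eq_mul_div, mul_comm, Complex.mul_conj, Complex.ofReal_div]
    simp only [hS]
    rw [e, Complex.ofReal_re, Complex.normSq_eq_norm_sq, hat, pow_two, mul_div_assoc, div_self hM.ne', mul_one]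
  have hlobe' := cos_lobe_of_sq_add_sq_le (S := fun s => S (lam₀ + s)) hM
    (hSdiff.comp (differentiable_id.const_add lam₀)) ?_ (by simp only [add_zero]; exact hS0) ht
  · calc M * Real.cos t ≤ S (lam₀ + t) := hlobe'
      _ ≤ ‖c * tfT g (lam₀ + t) 0‖ := le_trans (le_abs_self _) (Complex.abs_re_le_norm _)
      _ = ‖tfT g (lam₀ + t) 0‖ := by rw [norm_mul, hc1, one_mul]
  · intro s
    rw [deriv_comp_const_add]
    exact hDS (lam₀ + s)

/-- **LOBE PROFILE (blueprint step (5a)).**  If `‖tfT g · 0‖ ≤ M` with equality at `lam₀` (`M > 0`), then for every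
`κ ∈ [0, 1/2]` and `|t| ≤ π`:  `M·((25/24) cos t − D) ≤ ‖tfT g (lam₀ + t) κ‖`, `D = cosh ½ − 25/24 ≤ 0.086`
(the lobe at `κ = 0`, transported to `κ > 0` by the dent lemma with the `sinh κ/κ ≥ 1 + κ²/6` amplification). -/
theorem lobe_profile (g : ℝ → ℂ) (hg : Continuous g) {lam₀ M : ℝ} (hM : 0 < M)
    (hmax : ∀ y : ℝ, ‖tfT g y 0‖ ≤ M) (hat : ‖tfT g lam₀ 0‖ = M)
    {κ : ℝ} (hκ0 : 0 ≤ κ) (hκ : κ ≤ 1 / 2) {t : ℝ} (ht : |t| ≤ π) :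
    M * (25 / 24 * Real.cos t - (Real.cosh (1 / 2) - 25 / 24)) ≤ ‖tfT g (lam₀ + t) κ‖ := by
  have hlobe := lobe_at_max g hg hM hmax hat ht
  set D : ℝ := Real.cosh (1 / 2) - 25 / 24 with hD
  have hD12 : 1 / 12 ≤ D := D_bounds.1
  have hc1 : Real.cos t ≤ 1 := Real.cos_le_one t
  by_cases hct : 0 ≤ Real.cos t
  · rcases eq_or_lt_of_le hκ0 with h0 | hpos
    · rw [← h0]
      have h' : 25 / 24 * Real.cos t - D ≤ Real.cos t := by linarith
      exact le_trans (mul_le_mul_of_nonneg_left h' hM.le) hlobe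
    · have hdent := CoshKernel.norm_tfT_sub_le g hg κ hpos M hmax (lam₀ + t)
      set r : ℝ := Real.sinh κ / κ with hr
      have hr1 : 1 + κ ^ 2 / 6 ≤ r := by
        rw [hr, le_div_iff₀ hpos]
        have := SignConeRung.sinh_lower hpos.le
        have e : (1 + κ ^ 2 / 6) * κ = κ + κ ^ 3 / 6 := by ring
        linarith
      have hr0 : 0 ≤ r := le_trans (by positivity) hr1
      have hrev : r * ‖tfT g (lam₀ + t) 0‖ - (Real.cosh κ - r) * M ≤ ‖tfT g (lam₀ + t) κ‖ := by
        have h1 := norm_sub_norm_le ((r : ℂ) * tfT g (lam₀ + t) 0) (tfT g (lam₀ + t) κ)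
        have h2 : ‖(r : ℂ) * tfT g (lam₀ + t) 0‖ = r * ‖tfT g (lam₀ + t) 0‖ := by
          rw [norm_mul, Complex.norm_real, Real.norm_eq_abs, abs_of_nonneg hr0]
        rw [norm_sub_rev, h2] at h1
        linarith
      have e2 : r * (M * Real.cos t) ≤ r * ‖tfT g (lam₀ + t) 0‖ := mul_le_mul_of_nonneg_left hlobe hr0
      have hpsi := antitoneOn_psi (X := 1 + Real.cos t) (by linarith)
        (show κ ∈ Ici (0 : ℝ) from hκ0) (show (1 / 2 : ℝ) ∈ Ici (0 : ℝ) by norm_num) hκ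
      simp only at hpsi
      have e3 : (1 + κ ^ 2 / 6) * (1 + Real.cos t) ≤ r * (1 + Real.cos t) :=
        mul_le_mul_of_nonneg_right hr1 (by linarith)
      have e4 : M * ((1 + (1 / 2 : ℝ) ^ 2 / 6) * (1 + Real.cos t) - Real.cosh (1 / 2)) ≤
          M * (r * (1 + Real.cos t) - Real.cosh κ) := mul_le_mul_of_nonneg_left (by linarith) hM.le
      have e5 : M * (25 / 24 * Real.cos t - D) =
          M * ((1 + (1 / 2 : ℝ) ^ 2 / 6) * (1 + Real.cos t) - Real.cosh (1 / 2)) := by rw [hD]; ring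
      have e6 : M * (r * (1 + Real.cos t) - Real.cosh κ) = r * (M * Real.cos t) - (Real.cosh κ - r) * M := by
        ring
      rw [e5]
      linarith [e4, e6, e2, hrev]
  · have hneg : Real.cos t < 0 := not_le.mp hct
    have : M * (25 / 24 * Real.cos t - D) < 0 := mul_neg_of_pos_of_neg hM (by linarith)
    linarith [norm_nonneg (tfT g (lam₀ + t) κ)]

end profile
section parity
/-- the odd part of a test function. -/
noncomputable def oddPart (f : ℝ → ℂ) : ℝ → ℂ := fun u => (f u - f (-u)) / 2

/-- the even part of a test function. -/
noncomputable def evenPart (f : ℝ → ℂ) : ℝ → ℂ := fun u => (f u + f (-u)) / 2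

/-- `evenPart_add_oddPart` — helper of the x-wuc GEN-11 chain «K1′(ℝ) at the stake» (verbatim from the referee-passed extract `SplitXWucK1R.lean` 70c8eb2af2868881; role: see the module docstring). -/
theorem evenPart_add_oddPart (f : ℝ → ℂ) (u : ℝ) : evenPart f u + oddPart f u = f u := by
  simp only [oddPart, evenPart]; ring

/-- `oddPart_neg` — helper of the x-wuc GEN-11 chain «K1′(ℝ) at the stake» (verbatim from the referee-passed extract `SplitXWucK1R.lean` 70c8eb2af2868881; role: see the module docstring). -/
theorem oddPart_neg (f : ℝ → ℂ) (u : ℝ) : oddPart f (-u) = -oddPart f u := by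
  simp only [oddPart, neg_neg]; ring

/-- `evenPart_neg` — helper of the x-wuc GEN-11 chain «K1′(ℝ) at the stake» (verbatim from the referee-passed extract `SplitXWucK1R.lean` 70c8eb2af2868881; role: see the module docstring). -/
theorem evenPart_neg (f : ℝ → ℂ) (u : ℝ) : evenPart f (-u) = evenPart f u := by
  simp only [evenPart, neg_neg]; ring

/-- `continuous_oddPart` — helper of the x-wuc GEN-11 chain «K1′(ℝ) at the stake» (verbatim from the referee-passed extract `SplitXWucK1R.lean` 70c8eb2af2868881; role: see the module docstring). -/
theorem continuous_oddPart {f : ℝ → ℂ} (hf : Continuous f) : Continuous (oddPart f) := by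
  have h : Continuous (fun u : ℝ => f (-u)) := hf.comp continuous_neg
  unfold oddPart; fun_prop

/-- `continuous_evenPart` — helper of the x-wuc GEN-11 chain «K1′(ℝ) at the stake» (verbatim from the referee-passed extract `SplitXWucK1R.lean` 70c8eb2af2868881; role: see the module docstring). -/
theorem continuous_evenPart {f : ℝ → ℂ} (hf : Continuous f) : Continuous (evenPart f) := by
  have h : Continuous (fun u : ℝ => f (-u)) := hf.comp continuous_neg
  unfold evenPart; fun_prop

/-- `oddPart_im` — helper of the x-wuc GEN-11 chain «K1′(ℝ) at the stake» (verbatim from the referee-passed extract `SplitXWucK1R.lean` 70c8eb2af2868881; role: see the module docstring). -/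
theorem oddPart_im {f : ℝ → ℂ} (hf : ∀ u : ℝ, (f u).im = 0) (u : ℝ) : (oddPart f u).im = 0 := by
  apply Complex.conj_eq_iff_im.mp
  simp only [oddPart, map_div₀, map_sub, map_ofNat]
  rw [Complex.conj_eq_iff_im.mpr (hf u), Complex.conj_eq_iff_im.mpr (hf (-u))]

/-- `evenPart_im` — helper of the x-wuc GEN-11 chain «K1′(ℝ) at the stake» (verbatim from the referee-passed extract `SplitXWucK1R.lean` 70c8eb2af2868881; role: see the module docstring). -/
theorem evenPart_im {f : ℝ → ℂ} (hf : ∀ u : ℝ, (f u).im = 0) (u : ℝ) : (evenPart f u).im = 0 := by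
  apply Complex.conj_eq_iff_im.mp
  simp only [evenPart, map_div₀, map_add, map_ofNat]
  rw [Complex.conj_eq_iff_im.mpr (hf u), Complex.conj_eq_iff_im.mpr (hf (-u))]

/-- the integral over `[-1, 1]` of an odd function vanishes. -/
theorem integral_Icc_odd {φ : ℝ → ℂ} (hφ : ∀ u : ℝ, φ (-u) = -φ u) : ∫ u in Icc (-1 : ℝ) 1, φ u = 0 := by
  rw [integral_Icc_eq_integral_Ioc, ← intervalIntegral.integral_of_le (by norm_num : (-1 : ℝ) ≤ 1)]
  have h1 : ∫ x in (-1 : ℝ)..1, φ x = ∫ x in (-1 : ℝ)..1, φ (-x) := by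
    rw [intervalIntegral.integral_comp_neg]; norm_num
  have h2 : ∫ x in (-1 : ℝ)..1, φ (-x) = -∫ x in (-1 : ℝ)..1, φ x := by
    simp_rw [hφ]; exact intervalIntegral.integral_neg
  have h3 := h1.trans h2
  linear_combination (1 / 2 : ℂ) * h3

/-- reflection: `tfT (f ∘ neg) λ κ = tfT f (−λ) κ`. -/
theorem tfT_reflect (f : ℝ → ℂ) (lam κ : ℝ) : tfT (fun u => f (-u)) lam κ = tfT f (-lam) κ := by
  rw [CoshKernel.tfT_interval, CoshKernel.tfT_interval]
  have hφ : ∀ u : ℝ, f u * (Real.cosh (κ * u) : ℂ) * cexp (I * ((-lam : ℝ) : ℂ) * u) =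
      (fun v : ℝ => f (-v) * (Real.cosh (κ * v) : ℂ) * cexp (I * (lam : ℂ) * v)) (-u) := by
    intro u
    simp only [neg_neg, mul_neg, Real.cosh_neg, Complex.ofReal_neg]
    ring_nf
  rw [intervalIntegral.integral_congr (fun u _ => hφ u),
    intervalIntegral.integral_comp_neg (fun v : ℝ => f (-v) * (Real.cosh (κ * v) : ℂ) * cexp (I * (lam : ℂ) * v))]
  simp only [neg_neg]

/-- conjugation symmetry for real-valued `f`. -/
theorem tfT_neg' {f : ℝ → ℂ} (hf : ∀ u : ℝ, (f u).im = 0) (lam κ : ℝ) :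
    tfT f (-lam) κ = conj (tfT f lam κ) := by
  unfold tfT
  rw [← integral_conj]
  refine setIntegral_congr_fun measurableSet_Icc fun u _ ↦ ?_
  have hfu : conj (f u) = f u := Complex.conj_eq_iff_im.2 (hf u)
  simp only [map_mul, hfu, Complex.conj_ofReal, ← Complex.exp_conj, Complex.conj_I, Complex.ofReal_neg]
  ring_nf

/-- the transform of the odd part of a real `f` is purely imaginary. -/
theorem re_tfT_oddPart {f : ℝ → ℂ} (hf : ∀ u : ℝ, (f u).im = 0) (lam κ : ℝ) :
    (tfT (oddPart f) lam κ).re = 0 := by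
  have h1 : conj (tfT (oddPart f) lam κ) = tfT (oddPart f) (-lam) κ := (tfT_neg' (oddPart_im hf) lam κ).symm
  have h2 : tfT (oddPart f) (-lam) κ = -tfT (oddPart f) lam κ := by
    rw [← tfT_reflect]
    have : (fun u => oddPart f (-u)) = fun u => -oddPart f u := funext (oddPart_neg f)
    rw [this]
    simp only [tfT]
    rw [← integral_neg]
    congr 1; ext u; ring
  have h3 := congrArg Complex.re (h1.trans h2)
  simp only [Complex.conj_re, Complex.neg_re] at h3
  linarith

/-- the transform of the even part of a real `f` is real. -/
theorem im_tfT_evenPart {f : ℝ → ℂ} (hf : ∀ u : ℝ, (f u).im = 0) (lam κ : ℝ) :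
    (tfT (evenPart f) lam κ).im = 0 := by
  have h1 : conj (tfT (evenPart f) lam κ) = tfT (evenPart f) (-lam) κ := (tfT_neg' (evenPart_im hf) lam κ).symm
  have h2 : tfT (evenPart f) (-lam) κ = tfT (evenPart f) lam κ := by
    rw [← tfT_reflect]
    have : (fun u => evenPart f (-u)) = fun u => evenPart f u := funext (evenPart_neg f)
    rw [this]
  have h3 := congrArg Complex.im (h1.trans h2)
  simp only [Complex.conj_im] at h3
  linarith

/-- `tfT_split` — helper of the x-wuc GEN-11 chain «K1′(ℝ) at the stake» (verbatim from the referee-passed extract `SplitXWucK1R.lean` 70c8eb2af2868881; role: see the module docstring). -/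
theorem tfT_split {f : ℝ → ℂ} (hf : Continuous f) (lam κ : ℝ) :
    tfT f lam κ = tfT (evenPart f) lam κ + tfT (oddPart f) lam κ := by
  have he := continuous_evenPart hf
  have ho := continuous_oddPart hf
  simp only [tfT]
  rw [← integral_add]
  · apply setIntegral_congr_fun measurableSet_Icc
    intro u _
    simp only [← add_mul, evenPart_add_oddPart]
  · exact (by fun_prop : Continuous fun u : ℝ =>
      evenPart f u * (Real.cosh (κ * u) : ℂ) * cexp (I * (lam : ℂ) * u)).integrableOn_Icc
  · exact (by fun_prop : Continuous fun u : ℝ =>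
      oddPart f u * (Real.cosh (κ * u) : ℂ) * cexp (I * (lam : ℂ) * u)).integrableOn_Icc

/-- **parity reduction:** for real `f`, `‖tfT (oddPart f) λ κ‖ ≤ ‖tfT f λ κ‖`. -/
theorem norm_tfT_oddPart_le {f : ℝ → ℂ} (hf : ∀ u : ℝ, (f u).im = 0) (hfc : Continuous f) (lam κ : ℝ) :
    ‖tfT (oddPart f) lam κ‖ ≤ ‖tfT f lam κ‖ := by
  rw [tfT_split hfc]
  set E := tfT (evenPart f) lam κ
  set G := tfT (oddPart f) lam κ
  have hE : E.im = 0 := im_tfT_evenPart hf lam κ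
  have hG : G.re = 0 := re_tfT_oddPart hf lam κ
  have h : ‖G‖ ^ 2 ≤ ‖E + G‖ ^ 2 := by
    rw [Complex.sq_norm, Complex.sq_norm, Complex.normSq_apply, Complex.normSq_apply, Complex.add_re,
      Complex.add_im, hE, hG]
    nlinarith [sq_nonneg E.re]
  have := abs_le_of_sq_le_sq h (norm_nonneg _)
  rwa [abs_of_nonneg (norm_nonneg _)] at this

/-- the pairing only sees the odd part. -/
theorem pairing_oddPart {f : ℝ → ℂ} (hfc : Continuous f) (κ₀ : ℝ) :
    (∫ u in Icc (-1 : ℝ) 1, 2 * (Real.sinh (κ₀ * u) : ℂ) * f u) =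
      ∫ u in Icc (-1 : ℝ) 1, 2 * (Real.sinh (κ₀ * u) : ℂ) * oddPart f u := by
  have he := continuous_evenPart hfc
  have ho := continuous_oddPart hfc
  have hsplit : ∀ u : ℝ, 2 * (Real.sinh (κ₀ * u) : ℂ) * f u =
      2 * (Real.sinh (κ₀ * u) : ℂ) * evenPart f u + 2 * (Real.sinh (κ₀ * u) : ℂ) * oddPart f u := by
    intro u; rw [← mul_add, evenPart_add_oddPart]
  simp_rw [hsplit]
  rw [integral_add, integral_Icc_odd, zero_add]
  · intro u
    simp only [mul_neg, Real.sinh_neg, Complex.ofReal_neg, evenPart_neg]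
    ring
  · exact (by fun_prop : Continuous fun u : ℝ => 2 * (Real.sinh (κ₀ * u) : ℂ) * evenPart f u).integrableOn_Icc
  · exact (by fun_prop : Continuous fun u : ℝ => 2 * (Real.sinh (κ₀ * u) : ℂ) * oddPart f u).integrableOn_Icc

/-- `tfT_oddPart_zero` — helper of the x-wuc GEN-11 chain «K1′(ℝ) at the stake» (verbatim from the referee-passed extract `SplitXWucK1R.lean` 70c8eb2af2868881; role: see the module docstring). -/
theorem tfT_oddPart_zero (f : ℝ → ℂ) : tfT (oddPart f) 0 0 = 0 := by
  simp only [tfT, zero_mul, Real.cosh_zero, Complex.ofReal_one, mul_one, Complex.ofReal_zero, mul_zero,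
    Complex.exp_zero]
  exact integral_Icc_odd (oddPart_neg f)

/-- `norm_tfT_oddPart_neg` — helper of the x-wuc GEN-11 chain «K1′(ℝ) at the stake» (verbatim from the referee-passed extract `SplitXWucK1R.lean` 70c8eb2af2868881; role: see the module docstring). -/
theorem norm_tfT_oddPart_neg {f : ℝ → ℂ} (hf : ∀ u : ℝ, (f u).im = 0) (lam κ : ℝ) :
    ‖tfT (oddPart f) (-lam) κ‖ = ‖tfT (oddPart f) lam κ‖ := by
  rw [tfT_neg' (oddPart_im hf), RCLike.norm_conj]

end parity
section levels
/-- **level sums:** a nested-level certificate `t_j = ℓ_j − ℓ_{j+1}` (ℓ antitone, ≥ 0) over any index set `A ⊆ [0,k)`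
is bounded by `P` as soon as every active level is: `ℓ_j ≤ P` for `j ∈ A`. -/
theorem level_sum_le {k : ℕ} (ℓ : ℕ → ℝ) (hℓ : ∀ j, ℓ (j + 1) ≤ ℓ j) (hℓ0 : ∀ j, 0 ≤ ℓ j)
    (A : Finset ℕ) (hA : A ⊆ Finset.range k) {P : ℝ} (hP : 0 ≤ P) (key : ∀ j ∈ A, ℓ j ≤ P) :
    (∑ j ∈ A, (ℓ j - ℓ (j + 1))) ≤ P := by
  rcases A.eq_empty_or_nonempty with h | hne
  · simp [h, hP]
  · set j₀ := A.min' hne with hj₀def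
    have hj₀ : j₀ ∈ A := A.min'_mem hne
    have hj₀k : j₀ < k := Finset.mem_range.mp (hA hj₀)
    have hsub : A ⊆ Finset.Ico j₀ k := fun j hj =>
      Finset.mem_Ico.mpr ⟨A.min'_le j hj, Finset.mem_range.mp (hA hj)⟩
    calc (∑ j ∈ A, (ℓ j - ℓ (j + 1))) ≤ ∑ j ∈ Finset.Ico j₀ k, (ℓ j - ℓ (j + 1)) :=
          Finset.sum_le_sum_of_subset_of_nonneg hsub (fun j _ _ => by linarith [hℓ j])
      _ = ℓ j₀ - ℓ k := by
          rw [Finset.sum_Ico_eq_sum_range]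
          have e := Finset.sum_range_sub' (fun r => ℓ (j₀ + r)) (k - j₀)
          simp only [add_zero] at e
          rw [Nat.add_sub_cancel' hj₀k.le] at e
          rw [← e]
          apply Finset.sum_congr rfl
          intro r _
          rw [add_assoc]
      _ ≤ P := by linarith [key j₀ hj₀, hℓ0 k]

end levels
section windows
/-- the 16 complementary angles `y_j` (windows have half-width `π/2 − y_j`), decreasing. -/
noncomputable def yL : List ℝ :=
  [789/1000, 189/250, 181/250, 173/250, 659/1000, 313/500, 74/125, 279/500, 523/1000, 487/1000, 449/1000,
    41/100, 369/1000, 13/40, 277/1000, 221/1000]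

/-- the 16 level heights `s_j ≤ (25/24)(y_j − y_j³/6) − 0.086`, decreasing. -/
noncomputable def sL : List ℝ :=
  [3253/5000, 783/1250, 3011/5000, 5773/10000, 5507/10000, 2617/5000, 2473/5000, 93/200, 4339/10000,
    1003/2500, 3659/10000, 3291/10000, 181/625, 493/2000, 497/2500, 1423/10000]

/-- `yN` — helper of the x-wuc GEN-11 chain «K1′(ℝ) at the stake» (verbatim from the referee-passed extract `SplitXWucK1R.lean` 70c8eb2af2868881; role: see the module docstring). -/
noncomputable def yN (j : ℕ) : ℝ := if j < 16 then yL.getD j 0 else 0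

/-- `sN` — helper of the x-wuc GEN-11 chain «K1′(ℝ) at the stake» (verbatim from the referee-passed extract `SplitXWucK1R.lean` 70c8eb2af2868881; role: see the module docstring). -/
noncomputable def sN (j : ℕ) : ℝ := if j < 16 then sL.getD j 0 else 0

/-- `yN_mem` — helper of the x-wuc GEN-11 chain «K1′(ℝ) at the stake» (verbatim from the referee-passed extract `SplitXWucK1R.lean` 70c8eb2af2868881; role: see the module docstring). -/
theorem yN_mem (j : ℕ) (hj : j < 16) : 221 / 1000 ≤ yN j ∧ yN j ≤ 789 / 1000 := by
  interval_cases j <;> norm_num [yN, yL]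

/-- `sN_cert` — helper of the x-wuc GEN-11 chain «K1′(ℝ) at the stake» (verbatim from the referee-passed extract `SplitXWucK1R.lean` 70c8eb2af2868881; role: see the module docstring). -/
theorem sN_cert (j : ℕ) (hj : j < 16) : 0 ≤ sN j ∧ sN j ≤ 25 / 24 * (yN j - yN j ^ 3 / 6) - 43 / 500 := by
  interval_cases j <;> norm_num [yN, yL, sN, sL]

/-- `sN_nonneg` — helper of the x-wuc GEN-11 chain «K1′(ℝ) at the stake» (verbatim from the referee-passed extract `SplitXWucK1R.lean` 70c8eb2af2868881; role: see the module docstring). -/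
theorem sN_nonneg (j : ℕ) : 0 ≤ sN j := by
  by_cases hj : j < 16
  · exact (sN_cert j hj).1
  · simp [sN, hj]

/-- `sN_succ_le` — helper of the x-wuc GEN-11 chain «K1′(ℝ) at the stake» (verbatim from the referee-passed extract `SplitXWucK1R.lean` 70c8eb2af2868881; role: see the module docstring). -/
theorem sN_succ_le (j : ℕ) : sN (j + 1) ≤ sN j := by
  by_cases hj : j < 16
  · interval_cases j <;> norm_num [sN, sL]
  · have h1 : ¬ (j + 1 < 16) := by omega
    simp [sN, hj, h1]

/-- the certified per-lobe credit: `Σ_j (s_j² − s_{j+1}²)(1.641592 − 2 y_j) ≥ 0.2284`. -/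
theorem credit16 : (571 : ℝ) / 2500 ≤
    ∑ j ∈ Finset.range 16, (sN j ^ 2 - sN (j + 1) ^ 2) * (1641592 / 1000000 - 2 * yN j) := by
  simp only [Finset.sum_range_succ, Finset.sum_range_zero]
  norm_num [sN, sL, yN, yL]

end windows
end Summit.RiemannHypothesis.RiemannHypothesis.Theorems.Splittings.XWucG8.DSLine
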